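import Literature.MathematicalPhysics.QuantumFieldTheory.BalabanImbrieJaffe1984to88.BIJ88Sect5StatementsPart2
import Literature.MathematicalPhysics.QuantumFieldTheory.BalabanImbrieJaffe1984to88.BIJ88ScaleSums

/-!
# `BalabanImbrieJaffe1984to88.BIJ88Ineq579Second` — T. Bałaban, J. Imbrie, A. Jaffe, *Effective action and cluster properties of
the abelian Higgs model*, Commun. Math. Phys. **114** (1988) 257–315 [BalabanImbrieJaffe1988]: the SECOND inequality of **(5.7.9)**
p. 291 [PDF 35] — *"|W^{(j)′}(X)| ≤ e_j^{n̄+1−α} e^{−cr(e_k)|X|^−} (r(e_k)L^{k−j})^d |X| ≤ e_j^κ e^{−cr(e_k)|X|^−}. (5.7.9) We can take κ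
arbitrarily large by increasing n̄. The high power of e_j beats the big factor (r(e_k)L^{k−j})^d, the volume of an elementary cube
measured on the j-th scale."* — PROVED in its generic-constant reading (the second `c` a smaller constant: here `c/2`) with an
EXPLICIT `κ = n̄ + 1 − α − 2d/(4−d) − θ` on r18's running charge (2.2) `eK` and localization length (2.3) `rLen`; and the kernel fact that
the ONE-LETTER reading (the same `c` on both sides, as in r16's verbatim leaf `BIJ88Sect5StatementsPart2.Ineq579`) is unsatisfiable on
any polymer system with unbounded `|X|` (the factor `|X|` cannot be absorbed without spending decay).

statement-level skeleton of published theorems with citation tags; proofs where landed; nothing here is a claim about the Yang–Mills mass gap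

PDF held: `paper:balaban1988-cmp114-bij-abelian-higgs-effective-action` (journal page = PDF page + 256).  Page read as image: PDF p. 35
(journal 291), `g4png.py` ×2 render (seat folder `renders/original-p035-x2.png`).

CITATION HEADER (lean-in-tree rule).  Part of the lit-balaban TYPED SKELETON (HOME `run/shared/lean/pub/lit-balaban/`), Phase 2,
seat p36 (gen 4, unit `lit-balaban-p36`); row **C2.Eq5.7.7-5.7.9** of `HOME/lit-balaban-r16/ROWS-C2-part2.md` (leaf `Ineq579` typed
p240155, r16); multiscale arithmetic from the companion `BIJ88ScaleSums` (same seat, p250210).  WHAT IS REPRODUCED (theorem-only; every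
constant explicit; no new `Prop` facts; axioms standard):
* §1 *"the volume of an elementary cube measured on the j-th scale"*: with (2.2) `e_j = e_k L^{−(4−d)(k−j)/2}` the scaling factor is
  EXACTLY a ratio of charges, `(L^{k−j})^d = e_k^{2d/(4−d)} · e_j^{−2d/(4−d)}` (`pow_L_eq_rpow_eK`); the volume count `|X| = |X|^− + 1` costs
  half the decay: `|X| e^{−c r(e_k)|X|^−} ≤ e^{−(c/2) r(e_k)|X|^−}` once `(c/2)·r(e_k) ≥ 1` (`card_mul_exp_le`).
* §2 `ineq579_second`: for `L > 1`, `d < 4`, `0 < e_k ≤ 1`, `|X| ≥ 1`, `(c/2)r(e_k) ≥ 1`, and `θ > 0` with `r(e_k)^d ≤ e_k^{−θ}` (polylog vs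
  power, `e_k` small): **`e_j^{n̄+1−α} e^{−cr(e_k)|X|^−}(r(e_k)L^{k−j})^d|X| ≤ e_j^κ e^{−(c/2)r(e_k)|X|^−}`, `κ = n̄ + 1 − α − 2d/(4−d) − θ`** —
  *"κ arbitrarily large by increasing n̄"*.  Hence `ineq579_twoConst`: the first printed inequality for a functional `W′` implies the
  pair with the two constants `c`, `c/2`.
* §3 `not_ineq579_of_unbounded`: READING NOTE with kernel evidence — the verbatim one-letter leaf `Ineq579 P W′ e_j r_k L^{k−j} d n̄ α κ c`
  (second conjunct `e_j^{n̄+1−α}e^{−cr_k|X|^−}(r_kL^{k−j})^d|X| ≤ e_j^κ e^{−cr_k|X|^−}`, the SAME `c`) fails for EVERY `W′` as soon as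
  `|X|` is unbounded on the polymer system and `e_j, r_k L^{k−j} > 0` (recorded in HOME/GAPS.md; the §2 form is what the sentence proves).
NOT here: the first inequality of (5.7.9) (the perturbative/random-walk content of `W^{(j)′}`), (5.7.7)–(5.7.8).
-/

namespace Literature.MathematicalPhysics.QuantumFieldTheory.BalabanImbrieJaffe1984to88.BIJ88Ineq579Second

open Finset
open BIJ88Sect2Statements (rLen eK)
open BIJ88Sect5StatementsPart2 BIJ88ScaleSums

/-! ## §1 The scaling factor as a ratio of charges; the volume count against half the decay -/

section Scaling

variable {L ε e₀ : ℝ} {d : ℕ}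

/-- *"(r(e_k)L^{k−j})^d, the volume of an elementary cube measured on the j-th scale"*: with (2.2) `e_j = e_k·L^{−(4−d)(k−j)/2}` the
pure scaling factor is a ratio of running charges, `(L^{k−j})^d = e_k^{2d/(4−d)} · e_j^{−2d/(4−d)}` (`L, ε, e > 0`, `d < 4`, `j ≤ k`).
[cite: BalabanImbrieJaffe1988, (5.7.9) p.291] -/
theorem pow_L_eq_rpow_eK (hL : 0 < L) (hε : 0 < ε) (he₀ : 0 < e₀) (hd : d < 4) {j k : ℕ} (hj : j ≤ k) :
    ((L ^ (k - j)) ^ d : ℝ) =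
      eK L ε e₀ d k ^ (2 * (d : ℝ) / (4 - (d : ℝ))) * eK L ε e₀ d j ^ (-(2 * (d : ℝ) / (4 - (d : ℝ)))) := by
  have hd' : (d : ℝ) < 4 := by exact_mod_cast hd
  have hs : 0 < (4 - (d : ℝ)) / 2 := by linarith
  have hek : 0 < eK L ε e₀ d k := eK_pos hL hε he₀ k
  have hq : 0 < L ^ (-((4 - (d : ℝ)) / 2)) := Real.rpow_pos_of_pos hL _
  rw [eK_scale hL hε e₀ hj, Real.mul_rpow hek.le (pow_nonneg hq.le _), ← mul_assoc, ← Real.rpow_add hek]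
  have h0 : 2 * (d : ℝ) / (4 - (d : ℝ)) + -(2 * (d : ℝ) / (4 - (d : ℝ))) = 0 := by ring
  rw [h0, Real.rpow_zero, one_mul, ← Real.rpow_natCast (L ^ (-((4 - (d : ℝ)) / 2))) (k - j), ← Real.rpow_mul hL.le,
    ← Real.rpow_mul hL.le, ← Real.rpow_natCast (L ^ (k - j)) d, ← Real.rpow_natCast L (k - j), ← Real.rpow_mul hL.le]
  have h4 : (4 - (d : ℝ)) ≠ 0 := (by linarith : (0 : ℝ) < 4 - d).ne'
  congr 1
  field_simp

/-- The volume count costs half the decay: for `n ≥ 1` and `a ≥ 1`, `n·e^{−2a(n−1)} ≤ e^{−a(n−1)}` (i.e. `|X| e^{−cr(e_k)|X|^−} ≤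
e^{−(c/2)r(e_k)|X|^−}` once `(c/2)r(e_k) ≥ 1`), from `1 + t ≤ e^t`. [cite: BalabanImbrieJaffe1988, (5.7.9) p.291] -/
theorem card_mul_exp_le {n a : ℝ} (hn : 1 ≤ n) (ha : 1 ≤ a) :
    n * Real.exp (-(2 * a) * (n - 1)) ≤ Real.exp (-a * (n - 1)) := by
  have h1 : n ≤ Real.exp (a * (n - 1)) := by
    calc n = (n - 1) + 1 := by ring
      _ ≤ a * (n - 1) + 1 := by nlinarith
      _ ≤ Real.exp (a * (n - 1)) := by linarith [Real.add_one_le_exp (a * (n - 1))]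
  have h2 : Real.exp (-(2 * a) * (n - 1)) = Real.exp (-a * (n - 1)) * (Real.exp (a * (n - 1)))⁻¹ := by
    rw [← Real.exp_neg, ← Real.exp_add]; ring_nf
  rw [h2]
  have he : 0 < Real.exp (a * (n - 1)) := Real.exp_pos _
  calc n * (Real.exp (-a * (n - 1)) * (Real.exp (a * (n - 1)))⁻¹)
      = Real.exp (-a * (n - 1)) * (n / Real.exp (a * (n - 1))) := by rw [div_eq_mul_inv]; ring
    _ ≤ Real.exp (-a * (n - 1)) * 1 :=
        mul_le_mul_of_nonneg_left ((div_le_one he).mpr h1) (Real.exp_pos _).le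
    _ = Real.exp (-a * (n - 1)) := mul_one _

end Scaling

/-! ## §2 (5.7.9), second inequality: *"The high power of e_j beats the big factor (r(e_k)L^{k−j})^d"* -/

section Second

variable (P : PolymerSys) {L ε e₀ : ℝ} {d : ℕ}

/-- **(5.7.9), second inequality, PROVED with explicit κ and the second constant halved**: on (2.2)/(2.3) with `L > 1`, `d < 4`,
`0 < e_k ≤ 1`, for a polymer with `|X| ≥ 1`, `c` with `(c/2)·r(e_k) ≥ 1`, and `θ > 0` with `r(e_k)^d ≤ e_k^{−θ}`:
`e_j^{n̄+1−α} e^{−cr(e_k)|X|^−} (r(e_k)L^{k−j})^d |X| ≤ e_j^κ e^{−(c/2)r(e_k)|X|^−}` with `κ = n̄ + 1 − α − 2d/(4−d) − θ` (j ≤ k).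
[cite: BalabanImbrieJaffe1988, (5.7.9) p.291] -/
theorem ineq579_second (hL : 1 < L) (hε : 0 < ε) (he₀ : 0 < e₀) (hd : d < 4) {j k : ℕ} (hj : j ≤ k)
    (hek1 : eK L ε e₀ d k ≤ 1) {r c θ α : ℝ} {nbar : ℕ} (hθ : 0 < θ) (hc : 1 ≤ c / 2 * rLen r (eK L ε e₀ d k))
    (hpoly : rLen r (eK L ε e₀ d k) ^ d ≤ eK L ε e₀ d k ^ (-θ)) {X : P.Poly} (hX : 1 ≤ P.card X) :
    eK L ε e₀ d j ^ ((nbar : ℝ) + 1 - α) * Real.exp (-(c * rLen r (eK L ε e₀ d k)) * P.cardMinus X) *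
        (rLen r (eK L ε e₀ d k) * L ^ (k - j)) ^ d * P.card X ≤
      eK L ε e₀ d j ^ ((nbar : ℝ) + 1 - α - 2 * (d : ℝ) / (4 - (d : ℝ)) - θ) *
        Real.exp (-(c / 2 * rLen r (eK L ε e₀ d k)) * P.cardMinus X) := by
  have hL0 : 0 < L := by linarith
  set ek := eK L ε e₀ d k with hek_def
  set ej := eK L ε e₀ d j with hej_def
  set rk := rLen r ek with hrk_def
  have hek : 0 < ek := eK_pos hL0 hε he₀ k
  obtain ⟨hq0, hq1⟩ := ratio_pos_lt_one hL hd
  obtain ⟨hej0, hejk0⟩ := scale_pos_le (eK_scale_family (d := d) hL0 hε e₀ k) hq0 hq1.le hek hj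
  have hej : 0 < ej := hej0
  have hejk : ej ≤ ek := hejk0
  have hej1 : ej ≤ 1 := hejk.trans hek1
  have hrk0 : 0 ≤ rk := by unfold rk rLen; exact Real.rpow_nonneg (abs_nonneg _) _
  -- the volume count against half the decay
  have hn : (1 : ℝ) ≤ P.card X := by exact_mod_cast hX
  have hm : (P.cardMinus X : ℝ) = (P.card X : ℝ) - 1 := by
    unfold PolymerSys.cardMinus; rw [Nat.cast_sub hX, Nat.cast_one]
  have hvol : (P.card X : ℝ) * Real.exp (-(c * rk) * P.cardMinus X) ≤ Real.exp (-(c / 2 * rk) * P.cardMinus X) := by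
    have h := card_mul_exp_le hn hc
    rw [hm]
    have e1 : -(c * rk) * ((P.card X : ℝ) - 1) = -(2 * (c / 2 * rk)) * ((P.card X : ℝ) - 1) := by ring
    rw [e1]
    exact h
  -- the scaling factor and the polylog against powers of e_j
  have hLd : ((L ^ (k - j)) ^ d : ℝ) = ek ^ (2 * (d : ℝ) / (4 - (d : ℝ))) * ej ^ (-(2 * (d : ℝ) / (4 - (d : ℝ)))) :=
    pow_L_eq_rpow_eK hL0 hε he₀ hd hj
  have hd' : (d : ℝ) < 4 := by exact_mod_cast hd
  have hsd : 0 ≤ 2 * (d : ℝ) / (4 - (d : ℝ)) := div_nonneg (by positivity) (by linarith)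
  have hek_pow : ek ^ (2 * (d : ℝ) / (4 - (d : ℝ))) ≤ 1 := Real.rpow_le_one hek.le hek1 hsd
  have hrd : rk ^ d ≤ ej ^ (-θ) :=
    hpoly.trans (Real.rpow_le_rpow_of_nonpos hej hejk (by linarith))
  have hfac : (rk * L ^ (k - j)) ^ d ≤ ej ^ (-(2 * (d : ℝ) / (4 - (d : ℝ)))) * ej ^ (-θ) := by
    rw [mul_pow, hLd]
    calc rk ^ d * (ek ^ (2 * (d : ℝ) / (4 - (d : ℝ))) * ej ^ (-(2 * (d : ℝ) / (4 - (d : ℝ)))))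
        ≤ ej ^ (-θ) * (1 * ej ^ (-(2 * (d : ℝ) / (4 - (d : ℝ))))) := by
          refine mul_le_mul hrd (mul_le_mul_of_nonneg_right hek_pow (Real.rpow_nonneg hej.le _))
            (mul_nonneg (Real.rpow_nonneg hek.le _) (Real.rpow_nonneg hej.le _)) (Real.rpow_nonneg hej.le _)
      _ = ej ^ (-(2 * (d : ℝ) / (4 - (d : ℝ)))) * ej ^ (-θ) := by ring
  have hexp : ej ^ ((nbar : ℝ) + 1 - α) * (ej ^ (-(2 * (d : ℝ) / (4 - (d : ℝ)))) * ej ^ (-θ)) =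
      ej ^ ((nbar : ℝ) + 1 - α - 2 * (d : ℝ) / (4 - (d : ℝ)) - θ) := by
    rw [← Real.rpow_add hej, ← Real.rpow_add hej]; ring_nf
  -- assemble
  have hE0 : 0 ≤ Real.exp (-(c * rk) * P.cardMinus X) := (Real.exp_pos _).le
  have hA0 : 0 ≤ ej ^ ((nbar : ℝ) + 1 - α) := Real.rpow_nonneg hej.le _
  calc ej ^ ((nbar : ℝ) + 1 - α) * Real.exp (-(c * rk) * P.cardMinus X) * (rk * L ^ (k - j)) ^ d * P.card X
      = (ej ^ ((nbar : ℝ) + 1 - α) * (rk * L ^ (k - j)) ^ d) * ((P.card X : ℝ) * Real.exp (-(c * rk) * P.cardMinus X)) := by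
        ring
    _ ≤ (ej ^ ((nbar : ℝ) + 1 - α) * (ej ^ (-(2 * (d : ℝ) / (4 - (d : ℝ)))) * ej ^ (-θ))) *
          Real.exp (-(c / 2 * rk) * P.cardMinus X) :=
        mul_le_mul (mul_le_mul_of_nonneg_left hfac hA0) hvol (mul_nonneg (Nat.cast_nonneg _) hE0)
          (mul_nonneg hA0 (mul_nonneg (Real.rpow_nonneg hej.le _) (Real.rpow_nonneg hej.le _)))
    _ = ej ^ ((nbar : ℝ) + 1 - α - 2 * (d : ℝ) / (4 - (d : ℝ)) - θ) * Real.exp (-(c / 2 * rk) * P.cardMinus X) := by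
        rw [hexp]

/-- **(5.7.9) with the two constants made explicit**: if `W′` obeys the first printed inequality at scale `j ≤ k`, then (under the
hypotheses of `ineq579_second`) `|W′(X)| ≤ e_j^{n̄+1−α}e^{−cr(e_k)|X|^−}(r(e_k)L^{k−j})^d|X| ≤ e_j^κ e^{−(c/2)r(e_k)|X|^−}` for every polymer.
[cite: BalabanImbrieJaffe1988, (5.7.9) p.291] -/
theorem ineq579_twoConst (hcard : ∀ X, 1 ≤ P.card X) (hL : 1 < L) (hε : 0 < ε) (he₀ : 0 < e₀) (hd : d < 4) {j k : ℕ}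
    (hj : j ≤ k) (hek1 : eK L ε e₀ d k ≤ 1) {r c θ α : ℝ} {nbar : ℕ} (hθ : 0 < θ)
    (hc : 1 ≤ c / 2 * rLen r (eK L ε e₀ d k)) (hpoly : rLen r (eK L ε e₀ d k) ^ d ≤ eK L ε e₀ d k ^ (-θ))
    (W' : P.Poly → ℝ)
    (hfirst : ∀ X, |W' X| ≤ eK L ε e₀ d j ^ ((nbar : ℝ) + 1 - α) *
      Real.exp (-(c * rLen r (eK L ε e₀ d k)) * P.cardMinus X) * (rLen r (eK L ε e₀ d k) * L ^ (k - j)) ^ d * P.card X)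
    (X : P.Poly) :
    |W' X| ≤ eK L ε e₀ d j ^ ((nbar : ℝ) + 1 - α) * Real.exp (-(c * rLen r (eK L ε e₀ d k)) * P.cardMinus X) *
        (rLen r (eK L ε e₀ d k) * L ^ (k - j)) ^ d * P.card X ∧
      eK L ε e₀ d j ^ ((nbar : ℝ) + 1 - α) * Real.exp (-(c * rLen r (eK L ε e₀ d k)) * P.cardMinus X) *
          (rLen r (eK L ε e₀ d k) * L ^ (k - j)) ^ d * P.card X ≤
        eK L ε e₀ d j ^ ((nbar : ℝ) + 1 - α - 2 * (d : ℝ) / (4 - (d : ℝ)) - θ) *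
          Real.exp (-(c / 2 * rLen r (eK L ε e₀ d k)) * P.cardMinus X) :=
  ⟨hfirst X, ineq579_second P hL hε he₀ hd hj hek1 hθ hc hpoly (hcard X)⟩

end Second

/-! ## §3 The one-letter reading of (5.7.9) is unsatisfiable when `|X|` is unbounded -/

section OneLetter

variable (P : PolymerSys)

/-- READING NOTE, kernel evidence: the verbatim leaf `Ineq579` (the same `c` in both exponentials) requires
`e_j^{n̄+1−α}(r_kL^{k−j})^d·|X| ≤ e_j^κ` for EVERY polymer `X` — impossible for any `W′` once `|X|` is unbounded and `e_j > 0`,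
`r_k L^{k−j} > 0`; the sentence after (5.7.9) is the two-constant statement `ineq579_second`. [cite: BalabanImbrieJaffe1988, (5.7.9) p.291] -/
theorem not_ineq579_of_unbounded (hunb : ∀ N : ℕ, ∃ X : P.Poly, N < P.card X) (W' : P.Poly → ℝ) {ej rk Lkj : ℝ}
    (hej : 0 < ej) (hrL : 0 < rk * Lkj) (d nbar : ℕ) (α κ c : ℝ) : ¬ Ineq579 P W' ej rk Lkj d nbar α κ c := by
  intro h
  -- the W′-independent second conjunct, with the common exponential factor cancelled
  set A := ej ^ ((nbar : ℝ) + 1 - α) * (rk * Lkj) ^ d with hA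
  have hA0 : 0 < A := mul_pos (Real.rpow_pos_of_pos hej _) (pow_pos hrL d)
  obtain ⟨N, hN⟩ := exists_nat_gt (ej ^ κ / A)
  obtain ⟨X, hX⟩ := hunb N
  have h2 := (h X).2
  have hE : 0 < Real.exp (-(c * rk) * P.cardMinus X) := Real.exp_pos _
  have h3 : A * (P.card X : ℝ) ≤ ej ^ κ := by
    have : ej ^ ((nbar : ℝ) + 1 - α) * Real.exp (-(c * rk) * P.cardMinus X) * (rk * Lkj) ^ d * P.card X =
        (A * P.card X) * Real.exp (-(c * rk) * P.cardMinus X) := by rw [hA]; ring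
    rw [this] at h2
    exact le_of_mul_le_mul_right h2 hE
  have h4 : (P.card X : ℝ) ≤ ej ^ κ / A := by rw [le_div_iff₀ hA0]; linarith
  have h5 : (N : ℝ) < P.card X := by exact_mod_cast hX
  linarith

end OneLetter

end Literature.MathematicalPhysics.QuantumFieldTheory.BalabanImbrieJaffe1984to88.BIJ88Ineq579Second
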